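import Summits.HodgeConjecture.HodgeConjecture.Theses.MirrorBraneLift
import Summits.HodgeConjecture.HodgeConjecture.Theses.TropicalWeilObstruction

/-!
# `TropicalWeilSupply` (crux `stmt-HodgeConjecture-18676`, route `MirrorBraneLift`) and the sibling
# crux `TropicalWeilObstruction.TropicalWeilVanishing` are mutually exclusive bets

Negative-lane certificate (refuter crux-attack, `--supports stmt-HodgeConjecture-18676`).

`MirrorBraneLift.TropicalWeilSupply` (T) asserts, for EVERY `n ≥ 2`, `δ ≥ 1` and every very general
member `P` of the tropical Weil family `𝓛_δ⁺` (`Literature.AlgebraicGeometry.Tropical.WeilFamily`),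
an effective tropical `n`-cycle `Z` on `ℝ²ⁿ/P.Q·ℤ²ⁿ` with `WeilFamily.functional δ Z ≠ 0`.
`TropicalWeilObstruction.TropicalWeilVanishing` (V, the `¬HC` bet of the sibling refutation route)
asserts, in the `δ = 1` vocabulary of `Literature.AlgebraicGeometry.Tropical.TorusCycles`
(`weilJ`, `IsWeilGeneric`, `weilFunctional`), that for `n = 4` and every positive definite `Q`
commuting with `weilJ 4` with algebraically independent free entries, EVERY effective tropical
4-cycle has `weilFunctional Z = 0`.

This file proves the dictionary between the two vocabularies at `δ = 1`,

* `WeilFamily.J n 1 = weilJ n`, `(weilJ n)ᵀ = -weilJ n`,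
* `Q * weilJ n = weilJ n * Q` with `Q` symmetric ⟹ `(J n 1 * Q)ᵀ = -(J n 1 * Q)` (so `Q` is a
  `WeilFamily.Polarization n 1`),
* `WeilFamily.frameDet n 1 = frameComplexDet n`, `WeilFamily.functional 1 Z = weilFunctional Z`,
* `IsWeilGeneric n Q → (⟨Q, _, _⟩ : WeilFamily.Polarization n 1).IsVeryGeneral` (re-indexing the `n²`
  free coordinates, using `Q_{a+n,b+n} = Q_{a,b}`, which follows from `QJ = JQ`),

and concludes `V → GenericWeilPeriod → ¬ T` (and symmetrically `GenericWeilPeriod → T → ¬ V`): given a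
very general Gaussian period matrix in dimension 8 (the sibling's support item `GenericWeilPeriod`,
true by a transcendence-degree argument, not proved here), at most one of the two cruxes holds.
Neither crux is decided here. [folklore]
-/

-- `Summit.HodgeConjecture.HodgeConjecture.Theorems…` is the mandated namespace (single-problem summit:
-- Problem = Summit), which `linter.dupNamespace` flags on every declaration; the lakefile turns the
-- linter off tree-wide (weak option), restated here so stand-alone elaboration is warning-free too.
set_option linter.dupNamespace false

namespace Summit.HodgeConjecture.HodgeConjecture.Theorems.TropicalWeilSupply.Negative

open scoped Matrix
open Literature.AlgebraicGeometry.Tropical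
open Summit.HodgeConjecture.HodgeConjecture.Theses

/-- `δ = 1`: multiplication by `√-1` of `WeilFamily` is the `weilJ` of `TorusCycles`. [folklore] -/
theorem J_one (n : ℕ) : WeilFamily.J n 1 = weilJ n := by
  ext a b
  simp [WeilFamily.J, weilJ]

/-- `weilJ n` is antisymmetric. [folklore] -/
theorem weilJ_transpose (n : ℕ) : (weilJ n)ᵀ = -weilJ n := by
  ext a b
  have ha := a.isLt
  have hb := b.isLt
  simp only [Matrix.transpose_apply, Matrix.neg_apply, weilJ]
  split_ifs <;> first | omega | norm_num

/-- A symmetric `Q` commuting with `weilJ n` is `J`-skew in the sense of `WeilFamily.Polarization`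
(`δ = 1`). [folklore] -/
theorem skew_of_commute {n : ℕ} {Q : Matrix (Fin (2 * n)) (Fin (2 * n)) ℝ} (hQ : Q.PosDef)
    (hcomm : Q * weilJ n = weilJ n * Q) :
    (WeilFamily.J n 1 * Q)ᵀ = -(WeilFamily.J n 1 * Q) := by
  have hsym : Qᵀ = Q := by
    have h := hQ.1
    rw [Matrix.IsHermitian, Matrix.conjTranspose_eq_transpose_of_trivial] at h
    exact h
  rw [J_one, Matrix.transpose_mul, weilJ_transpose, hsym, Matrix.mul_neg, hcomm]

/-- `δ = 1`: `WeilFamily.frameDet n 1 = frameComplexDet n`. [folklore] -/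
theorem frameDet_one (n : ℕ) (L : Matrix (Fin (2 * n)) (Fin n) ℤ) :
    WeilFamily.frameDet n 1 L = frameComplexDet n L := by
  unfold WeilFamily.frameDet frameComplexDet
  congr 1
  ext k j
  simp only [Matrix.of_apply, Nat.cast_one, Real.sqrt_one, Complex.ofReal_one]
  ring

/-- `δ = 1`: the `ℚ(√-δ)` Weil functional of `WeilFamily` is the Gaussian `weilFunctional` of
`TorusCycles`. [folklore] -/
theorem functional_one {n : ℕ} {Q : Matrix (Fin (2 * n)) (Fin (2 * n)) ℝ}
    (Z : TropicalTorusCycle (2 * n) n Q) :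
    WeilFamily.functional 1 Z = weilFunctional Z := by
  unfold WeilFamily.functional weilFunctional
  simp_rw [frameDet_one]

/-- Entry formula: `(Q * weilJ n)_{a, b} = Q_{a, b+n}` for `b < n`. [folklore] -/
theorem mul_weilJ_apply_left {n : ℕ} (Q : Matrix (Fin (2 * n)) (Fin (2 * n)) ℝ)
    (a : Fin (2 * n)) (b : Fin n) :
    (Q * weilJ n) a ⟨(b : ℕ), by omega⟩ = Q a ⟨(b : ℕ) + n, by omega⟩ := by
  have hb := b.isLt
  rw [Matrix.mul_apply, Finset.sum_eq_single ⟨(b : ℕ) + n, by omega⟩]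
  · simp [weilJ]
  · intro c _ hc
    have hc' : (c : ℕ) ≠ (b : ℕ) + n := fun h => hc (Fin.ext h)
    have h1 : ¬ ((c : ℕ) = ((⟨(b : ℕ), by omega⟩ : Fin (2 * n)) : ℕ) + n) := fun h => hc' h
    have h2 : ¬ ((((⟨(b : ℕ), by omega⟩ : Fin (2 * n)) : ℕ)) = (c : ℕ) + n) := fun h => by
      change (b : ℕ) = (c : ℕ) + n at h
      omega
    simp only [weilJ, if_neg h1, if_neg h2, mul_zero]
  · intro h
    exact absurd (Finset.mem_univ _) h

/-- Entry formula: `(weilJ n * Q)_{a+n, b} = Q_{a, b}` for `a < n`. [folklore] -/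
theorem weilJ_mul_apply_right {n : ℕ} (Q : Matrix (Fin (2 * n)) (Fin (2 * n)) ℝ)
    (a : Fin n) (b : Fin (2 * n)) :
    (weilJ n * Q) ⟨(a : ℕ) + n, by omega⟩ b = Q ⟨(a : ℕ), by omega⟩ b := by
  have ha := a.isLt
  rw [Matrix.mul_apply, Finset.sum_eq_single ⟨(a : ℕ), by omega⟩]
  · simp [weilJ]
  · intro c _ hc
    have hc' : (c : ℕ) ≠ (a : ℕ) := fun h => hc (Fin.ext h)
    have hcl := c.isLt
    have h1 : ¬ ((((⟨(a : ℕ) + n, by omega⟩ : Fin (2 * n)) : ℕ)) = (c : ℕ) + n) := fun h => by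
      change (a : ℕ) + n = (c : ℕ) + n at h
      omega
    have h2 : ¬ ((c : ℕ) = (((⟨(a : ℕ) + n, by omega⟩ : Fin (2 * n)) : ℕ)) + n) := fun h => by
      change (c : ℕ) = (a : ℕ) + n + n at h
      omega
    simp only [weilJ, if_neg h1, if_neg h2, zero_mul]
  · intro h
    exact absurd (Finset.mem_univ _) h

/-- For `Q` commuting with `weilJ n` the lower-right block equals the upper-left block:
`Q_{a+n, b+n} = Q_{a, b}` (`a, b < n`). [folklore] -/
theorem apply_add_add_of_commute {n : ℕ} {Q : Matrix (Fin (2 * n)) (Fin (2 * n)) ℝ}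
    (hcomm : Q * weilJ n = weilJ n * Q) (a b : Fin n) :
    Q ⟨(a : ℕ) + n, by omega⟩ ⟨(b : ℕ) + n, by omega⟩ = Q ⟨(a : ℕ), by omega⟩ ⟨(b : ℕ), by omega⟩ := by
  have h := congrFun (congrFun hcomm ⟨(a : ℕ) + n, by omega⟩) ⟨(b : ℕ), by omega⟩
  rwa [mul_weilJ_apply_left, weilJ_mul_apply_right] at h

/-- Genericity dictionary (`δ = 1`): `IsWeilGeneric n Q` (algebraic independence of the `n²` free
entries indexed by `weilFreeIndex n`: upper triangle of the top-left block, strict upper triangle of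
the top-right block) implies `IsVeryGeneral` of `Q` as a member of `𝓛₁⁺` (free coordinates indexed
by `Fin n × Fin n`: upper triangle of the BOTTOM-RIGHT block, strict upper triangle of the top-right
block) — the two coordinate families agree after re-indexing because `Q_{a+n,b+n} = Q_{a,b}`.
[folklore] -/
theorem isVeryGeneral_of_isWeilGeneric {n : ℕ} {Q : Matrix (Fin (2 * n)) (Fin (2 * n)) ℝ}
    (hQ : Q.PosDef) (hcomm : Q * weilJ n = weilJ n * Q) (hgen : IsWeilGeneric n Q) :
    (⟨Q, skew_of_commute hQ hcomm, hQ⟩ : WeilFamily.Polarization n 1).IsVeryGeneral := by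
  classical
  -- the re-indexing map `Fin n × Fin n → weilFreeIndex n`
  let f : Fin n × Fin n → weilFreeIndex n := fun ab =>
    if h : (ab.1 : ℕ) ≤ ab.2 then
      ⟨(⟨(ab.1 : ℕ), by omega⟩, ⟨(ab.2 : ℕ), by omega⟩), ⟨h, Or.inl ab.2.isLt⟩⟩
    else
      ⟨(⟨(ab.2 : ℕ), by omega⟩, ⟨(ab.1 : ℕ) + n, by omega⟩),
        ⟨show (ab.2 : ℕ) ≤ (ab.1 : ℕ) + n by omega,
          Or.inr ⟨ab.2.isLt, show (ab.2 : ℕ) + n < (ab.1 : ℕ) + n by omega⟩⟩⟩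
  have fval1 : ∀ ab : Fin n × Fin n,
      ((f ab).1.1 : ℕ) = if (ab.1 : ℕ) ≤ ab.2 then (ab.1 : ℕ) else (ab.2 : ℕ) := by
    intro ab
    by_cases h : (ab.1 : ℕ) ≤ ab.2
    · simp only [f, dif_pos h, if_pos h]
    · simp only [f, dif_neg h, if_neg h]
  have fval2 : ∀ ab : Fin n × Fin n,
      ((f ab).1.2 : ℕ) = if (ab.1 : ℕ) ≤ ab.2 then (ab.2 : ℕ) else (ab.1 : ℕ) + n := by
    intro ab
    by_cases h : (ab.1 : ℕ) ≤ ab.2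
    · simp only [f, dif_pos h, if_pos h]
    · simp only [f, dif_neg h, if_neg h]
  have hf : Function.Injective f := by
    intro x y hxy
    have h1 : ((f x).1.1 : ℕ) = ((f y).1.1 : ℕ) := by rw [hxy]
    have h2 : ((f x).1.2 : ℕ) = ((f y).1.2 : ℕ) := by rw [hxy]
    rw [fval1, fval1] at h1
    rw [fval2, fval2] at h2
    have hx2 := x.2.isLt
    have hy2 := y.2.isLt
    refine Prod.ext (Fin.ext ?_) (Fin.ext ?_) <;> split_ifs at h1 h2 <;> omega
  have key : (fun ab : weilFreeIndex n => Q ab.1.1 ab.1.2) ∘ f =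
      WeilFamily.Polarization.coord
        (⟨Q, skew_of_commute hQ hcomm, hQ⟩ : WeilFamily.Polarization n 1) := by
    funext ab
    obtain ⟨a, b⟩ := ab
    by_cases hab : (a : ℕ) ≤ b
    · have hab' : a ≤ b := Fin.le_def.mpr hab
      simp only [Function.comp_apply, f, dif_pos hab, WeilFamily.Polarization.coord, if_pos hab']
      exact (apply_add_add_of_commute hcomm a b).symm
    · have hab' : ¬ a ≤ b := fun h => hab (Fin.le_def.mp h)
      simp only [Function.comp_apply, f, dif_neg hab, WeilFamily.Polarization.coord, if_neg hab']
  unfold WeilFamily.Polarization.IsVeryGeneral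
  rw [← key]
  exact hgen.comp f hf

/-- **Dichotomy.** The sibling refutation crux `TropicalWeilVanishing` (no effective tropical Weil
4-cycle on any very general Gaussian tropical Weil eightfold) together with its support item
`GenericWeilPeriod` (such an eightfold exists) refutes `TropicalWeilSupply` at `n = 4`, `δ = 1`.
[folklore] -/
theorem tropicalWeilSupply_false_of_tropicalWeilVanishing
    (hV : TropicalWeilObstruction.TropicalWeilVanishing)
    (hG : TropicalWeilObstruction.GenericWeilPeriod) :
    ¬ MirrorBraneLift.TropicalWeilSupply := by
  intro hT
  obtain ⟨Q, hQ, hcomm, hgen⟩ := hG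
  obtain ⟨Z, hZ⟩ := hT 4 (by norm_num) 1 le_rfl ⟨Q, skew_of_commute hQ hcomm, hQ⟩
    (isVeryGeneral_of_isWeilGeneric hQ hcomm hgen)
  exact hZ ((functional_one Z).trans (hV Q hQ hcomm hgen Z))

/-- **Dichotomy, symmetric form.** `TropicalWeilSupply` kills the sibling refutation route
`TropicalWeilObstruction` (given its own support item `GenericWeilPeriod`). [folklore] -/
theorem tropicalWeilVanishing_false_of_tropicalWeilSupply
    (hG : TropicalWeilObstruction.GenericWeilPeriod) (hT : MirrorBraneLift.TropicalWeilSupply) :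
    ¬ TropicalWeilObstruction.TropicalWeilVanishing :=
  fun hV => tropicalWeilSupply_false_of_tropicalWeilVanishing hV hG hT

/-- The three statements are jointly inconsistent. [folklore] -/
theorem not_supply_and_vanishing_and_genericPeriod :
    ¬ (MirrorBraneLift.TropicalWeilSupply ∧ TropicalWeilObstruction.TropicalWeilVanishing ∧
        TropicalWeilObstruction.GenericWeilPeriod) :=
  fun h => tropicalWeilSupply_false_of_tropicalWeilVanishing h.2.1 h.2.2 h.1

end Summit.HodgeConjecture.HodgeConjecture.Theorems.TropicalWeilSupply.Negative
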